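import Literature.Algebra.Semigroups.FullTransformationIdealCounts
import Literature.Algebra.Semigroups.FullTransformationIdempotents

/-!
# Maximal subgroups and group elements of `𝒯ₙ`

Source: O. Ganyushkin, V. Mazorchuk, *Classical Finite Transformation Semigroups*, Algebra and
Applications 9, Springer (2009) [GanyushkinMazorchuk2009], §5.1 "Subgroups" (Lemma 5.1.1,
Theorem 5.1.3, Theorem 5.1.4, the definition of a group element, Proposition 5.1.6 (i)) and
§4.7 (Theorem 4.7.4, 4.7.6), in the case of the full transformation monoid
`𝒯(X) = (X → X, ∘)`.

For an idempotent `ε` of a semigroup `S`, the *maximal subgroup* `G_ε` at `ε` is the group of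
units `(εSε)*` of the local submonoid `εSε` (Lemma 5.1.1, proof of Theorem 5.1.3 (i)); an
element of some `G_ε` is a *group element*.  Spelled out for `𝒯(X)` (no definitions):
`α ∈ G_ε` iff `εα = α = αε` and there is `β` with `εβ = β = βε`, `αβ = ε = βα`.

* Theorem 5.1.4 (i): `G_ε = {α : im α = im ε, ρ_α = ρ_ε}` (`mem_maximalSubgroup_iff`);
* Theorem 5.1.3 (ii) for `𝒯(X)`: the `G_ε` are pairwise disjoint — an idempotent is determined
  by its image and kernel (`idempotent_eq_of_range_eq_of_ker_eq`);
* Theorem 5.1.4 (ii) / Theorem 4.7.4: if `rank ε = k` then `G_ε ≅ 𝒮ₖ`: the map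
  `σ ↦ σ ∘ ε` from the symmetric group on `im ε` is multiplicative, unital, injective and has
  image exactly `G_ε` (`permMap_mul`, `permMap_one`, `permMap_injective`, `range_permMap_eq`);
* the definition of group elements made explicit for `𝒯(X)`: `α` is a group element iff `α`
  is injective on `im α` (equivalently, permutes `im α`) (`isGroupElement_iff_injOn`; cf.
  Exercise 5.1.5);
* Proposition 5.1.6 (i): `𝒯ₙ` contains `∑_{k=1}^{n} (n choose k) k^{n-k} k!` group elements
  (`card_groupElements`).
-/

namespace Literature.Algebra.Semigroups.FullTransformation

open Function Set
open scoped Nat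

variable {X : Type*}

/-! ### Theorem 5.1.4 (i): the maximal subgroup at an idempotent -/

/-- An idempotent `ε` of `𝒯(X)` restricted to `im ε` is the identity (Theorem 2.7.2).
[cite: GanyushkinMazorchuk2009, Theorem 2.7.2] -/
theorem apply_of_mem_range_idempotent {ε : X → X} (hε : ε ∘ ε = ε) {y : X} (hy : y ∈ range ε) :
    ε y = y :=
  (comp_self_eq_iff ε).1 hε y hy

/-- **Theorem 5.1.4 (i)** (case `𝒯ₙ`): for an idempotent `ε`, the maximal subgroup
`G_ε = (ε𝒯ε)*` consists exactly of the `α` with `im α = im ε` and `ρ_α = ρ_ε` (same image and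
same kernel partition as `ε`). No finiteness is needed.
[cite: GanyushkinMazorchuk2009, Theorem 5.1.4 (i)] -/
theorem mem_maximalSubgroup_iff {ε : X → X} (hε : ε ∘ ε = ε) (α : X → X) :
    (ε ∘ α = α ∧ α ∘ ε = α ∧
        ∃ β : X → X, (ε ∘ β = β ∧ β ∘ ε = β) ∧ α ∘ β = ε ∧ β ∘ α = ε) ↔
      range α = range ε ∧ ∀ x y, ε x = ε y ↔ α x = α y := by
  constructor
  · rintro ⟨h1, h2, β, -, h3, h4⟩
    refine ⟨Subset.antisymm ?_ ?_, fun x y => ⟨fun h => ?_, fun h => ?_⟩⟩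
    · rw [← h1]; exact range_comp_subset_range α ε
    · rw [← h3]; exact range_comp_subset_range β α
    · rw [← h2, comp_apply, comp_apply, h]
    · rw [← h4, comp_apply, comp_apply, h]
  · rintro ⟨hr, hk⟩
    have h1 : ε ∘ α = α := funext fun x =>
      apply_of_mem_range_idempotent hε (hr ▸ mem_range_self x)
    have h2 : α ∘ ε = α := funext fun x =>
      (hk _ _).1 (apply_of_mem_range_idempotent hε (mem_range_self x))
    -- `α` restricts to a permutation `σ` of `A = im ε`
    let A := range ε
    have hmem : ∀ x, α x ∈ A := fun x => by
      show α x ∈ range ε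
      rw [← hr]
      exact mem_range_self x
    let g : A → A := fun a => ⟨α a, hmem a⟩
    have hg : Bijective g := by
      constructor
      · rintro ⟨a, ha⟩ ⟨a', ha'⟩ h
        have h' : α a = α a' := congrArg Subtype.val h
        have := (hk a a').2 h'
        rw [apply_of_mem_range_idempotent hε ha, apply_of_mem_range_idempotent hε ha'] at this
        exact Subtype.ext this
      · rintro ⟨b, hb⟩
        obtain ⟨x, rfl⟩ : b ∈ range α := hr.symm ▸ hb
        exact ⟨⟨ε x, mem_range_self x⟩, Subtype.ext (congrFun h2 x)⟩
    let σ : A ≃ A := Equiv.ofBijective g hg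
    have hσ : ∀ a : A, (σ a : X) = α a := fun a => rfl
    refine ⟨h1, h2, fun x => (σ.symm ⟨ε x, mem_range_self x⟩ : X), ⟨?_, ?_⟩, ?_, ?_⟩
    · exact funext fun x => apply_of_mem_range_idempotent hε (σ.symm _).2
    · funext x
      simp only [comp_apply]
      rw [show (⟨ε (ε x), mem_range_self (ε x)⟩ : A) = ⟨ε x, mem_range_self x⟩ from
        Subtype.ext (congrFun hε x)]
    · funext x
      simp only [comp_apply]
      rw [← hσ, Equiv.apply_symm_apply]
    · funext x
      simp only [comp_apply]
      have : (⟨ε (α x), mem_range_self (α x)⟩ : A) = σ ⟨ε x, mem_range_self x⟩ := by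
        apply Subtype.ext
        rw [hσ]
        show (ε ∘ α) x = (α ∘ ε) x
        rw [h1, h2]
      rw [this, Equiv.symm_apply_apply]

/-- **Theorem 5.1.3 (ii)** in `𝒯(X)`: the maximal subgroups at different idempotents are
disjoint, because an idempotent of `𝒯(X)` is determined by its image and its kernel partition.
[cite: GanyushkinMazorchuk2009, Theorem 5.1.3 (ii)] -/
theorem idempotent_eq_of_range_eq_of_ker_eq {ε ε' : X → X} (hε : ε ∘ ε = ε) (hε' : ε' ∘ ε' = ε')
    (hr : range ε = range ε') (hk : ∀ x y, ε x = ε y ↔ ε' x = ε' y) : ε = ε' := by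
  funext x
  have h1 : ε' (ε x) = ε x := apply_of_mem_range_idempotent hε' (hr ▸ mem_range_self x)
  have h2 : ε' (ε x) = ε' x := (hk _ _).1 (congrFun hε x)
  rw [← h1, h2]

/-! ### Theorem 5.1.4 (ii), Theorem 4.7.4: `G_ε ≅ 𝒮ₖ` -/

/-- **Theorem 4.7.4** (compatibility with composition): for an idempotent `ε`, the map
`σ ↦ σε` from the symmetric group on `im ε` to `𝒯(X)` is multiplicative.
[cite: GanyushkinMazorchuk2009, Theorem 4.7.4] -/
theorem permMap_mul {ε : X → X} (hε : ε ∘ ε = ε) (σ τ : Equiv.Perm (range ε)) :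
    Subtype.val ∘ ⇑(σ * τ) ∘ rangeFactorization ε =
      (Subtype.val ∘ ⇑σ ∘ rangeFactorization ε) ∘ (Subtype.val ∘ ⇑τ ∘ rangeFactorization ε) := by
  funext x
  have h : rangeFactorization ε (τ (rangeFactorization ε x) : X) = τ (rangeFactorization ε x) :=
    Subtype.ext (apply_of_mem_range_idempotent hε (τ _).2)
  simp only [comp_apply, Equiv.Perm.coe_mul, h]

/-- **Theorem 4.7.4**: the map `σ ↦ σε` sends the identity permutation of `im ε` to `ε`.
[cite: GanyushkinMazorchuk2009, Theorem 4.7.4] -/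
theorem permMap_one (ε : X → X) :
    Subtype.val ∘ ⇑(1 : Equiv.Perm (range ε)) ∘ rangeFactorization ε = ε := by
  funext x; rfl

/-- **Theorem 4.7.4**: the map `σ ↦ σε` from the symmetric group on `im ε` is injective.
[cite: GanyushkinMazorchuk2009, Theorem 4.7.4] -/
theorem permMap_injective (ε : X → X) :
    Injective fun σ : Equiv.Perm (range ε) => Subtype.val ∘ ⇑σ ∘ rangeFactorization ε := by
  intro σ τ h
  ext z
  obtain ⟨x, rfl⟩ := rangeFactorization_surjective z
  exact congrFun h x

/-- **Theorem 5.1.4 (ii)** / **Theorem 4.7.4** (case `𝒯ₙ`, `X` finite): for an idempotent `ε`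
the image of `σ ↦ σε` is exactly the maximal subgroup `G_ε`; together with `permMap_mul`,
`permMap_one`, `permMap_injective` this says `G_ε ≅ 𝒮ₖ`, `k = rank ε`.
[cite: GanyushkinMazorchuk2009, Theorem 5.1.4 (ii)] -/
theorem range_permMap_eq [Finite X] {ε : X → X} (hε : ε ∘ ε = ε) :
    range (fun σ : Equiv.Perm (range ε) => Subtype.val ∘ ⇑σ ∘ rangeFactorization ε) =
      {α | ε ∘ α = α ∧ α ∘ ε = α ∧
        ∃ β : X → X, (ε ∘ β = β ∧ β ∘ ε = β) ∧ α ∘ β = ε ∧ β ∘ α = ε} := by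
  rw [← greenHClass_eq_range]
  ext α
  exact (mem_maximalSubgroup_iff hε α).symm

/-! ### Group elements -/

/-- The definition of a *group element* (an element of some maximal subgroup `G_ε`), made
explicit for `𝒯(X)`, `X` finite: `α` is a group element iff `α` is injective on `im α`, i.e.
iff `α` permutes `im α` (cf. Exercise 5.1.5 and Theorem 5.1.4 (i); the idempotent is
`ε = σ⁻¹α` for `σ = α|_{im α}`). [cite: GanyushkinMazorchuk2009, Theorem 5.1.4] -/
theorem isGroupElement_iff_injOn [Finite X] (α : X → X) :
    (∃ ε : X → X, ε ∘ ε = ε ∧ (ε ∘ α = α ∧ α ∘ ε = α ∧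
        ∃ β : X → X, (ε ∘ β = β ∧ β ∘ ε = β) ∧ α ∘ β = ε ∧ β ∘ α = ε)) ↔
      InjOn α (range α) := by
  constructor
  · rintro ⟨ε, hε, h⟩
    obtain ⟨hr, hk⟩ := (mem_maximalSubgroup_iff hε α).1 h
    intro a ha a' ha' h
    rw [hr] at ha ha'
    have := (hk a a').2 h
    rwa [apply_of_mem_range_idempotent hε ha, apply_of_mem_range_idempotent hε ha'] at this
  · intro hinj
    let A := range α
    let g : A → A := fun a => ⟨α a, mem_range_self _⟩
    have hg : Injective g := fun a a' h =>
      Subtype.ext (hinj a.2 a'.2 (congrArg Subtype.val h))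
    let σ : A ≃ A := Equiv.ofBijective g (Finite.injective_iff_bijective.1 hg)
    have hσ : ∀ a : A, (σ a : X) = α a := fun a => rfl
    let ε : X → X := fun x => (σ.symm ⟨α x, mem_range_self x⟩ : X)
    have hεA : ∀ x, (⟨α (ε x), mem_range_self (ε x)⟩ : A) = ⟨α x, mem_range_self x⟩ := by
      intro x
      have : (⟨α (ε x), mem_range_self (ε x)⟩ : A) = σ (σ.symm ⟨α x, mem_range_self x⟩) :=
        Subtype.ext (by rw [hσ])
      rw [this, Equiv.apply_symm_apply]
    have hε : ε ∘ ε = ε := by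
      funext x
      simp only [comp_apply]
      show (σ.symm ⟨α (ε x), mem_range_self (ε x)⟩ : X) = ε x
      rw [hεA]
    refine ⟨ε, hε, (mem_maximalSubgroup_iff hε α).2 ⟨Subset.antisymm ?_ ?_, fun x y => ?_⟩⟩
    · rintro _ ⟨x, rfl⟩
      refine ⟨α x, ?_⟩
      show (σ.symm ⟨α (α x), mem_range_self (α x)⟩ : X) = α x
      have : (⟨α (α x), mem_range_self (α x)⟩ : A) = σ ⟨α x, mem_range_self x⟩ :=
        Subtype.ext (by rw [hσ])
      rw [this, Equiv.symm_apply_apply]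
    · rintro _ ⟨x, rfl⟩
      exact (σ.symm _).2
    · show (σ.symm ⟨α x, mem_range_self x⟩ : X) = (σ.symm ⟨α y, mem_range_self y⟩ : X) ↔ _
      rw [Subtype.val_injective.eq_iff, σ.symm.injective.eq_iff, Subtype.mk.injEq]

/-- **Proposition 5.1.6 (i)**, fixed image (case `𝒯ₙ`): the group elements of `𝒯(X)` with image
a given subset `A` correspond to pairs (a permutation of `A`, an arbitrary map `X \ A → A`);
hence there are `|A|! · |A|^(n-|A|)` of them (`= (number of idempotents with image A) · |A|!`,
as in the printed proof via Theorems 5.1.3 (ii), 5.1.4 (ii) and Corollary 2.7.4).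
[cite: GanyushkinMazorchuk2009, Proposition 5.1.6 (i)] -/
theorem card_groupElements_image_eq [Fintype X] [DecidableEq X] (A : Finset X) :
    Nat.card {α : X → X // InjOn α (range α) ∧ Finset.univ.image α = A} =
      (A.card)! * A.card ^ (Fintype.card X - A.card) := by
  classical
  have himage : ∀ α : X → X, Finset.univ.image α = A ↔ range α = (A : Set X) := by
    intro α
    rw [← Finset.coe_inj, Finset.coe_image, Finset.coe_univ, image_univ]
  -- forward map to (permutation of `A`, map `Aᶜ → A`)
  have hbij : ∀ α : X → X, InjOn α (range α) ∧ Finset.univ.image α = A →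
      ∀ a : A, α a ∈ A := by
    rintro α ⟨-, hA⟩ a
    have := Finset.mem_image_of_mem α (Finset.mem_univ (a : X))
    rwa [hA] at this
  let toPerm : {α : X → X // InjOn α (range α) ∧ Finset.univ.image α = A} → Equiv.Perm A :=
    fun α => Equiv.ofBijective (fun a => ⟨α.1 a, hbij α.1 α.2 a⟩)
      (Finite.injective_iff_bijective.1 fun a a' h => by
        have hA : range α.1 = (A : Set X) := (himage α.1).1 α.2.2
        exact Subtype.ext (α.2.1 (hA.symm ▸ a.2) (hA.symm ▸ a'.2) (congrArg Subtype.val h)))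
  have htoPerm : ∀ α a, (toPerm α a : X) = α.1 a := fun α a => rfl
  have hcompl : ∀ α : X → X, InjOn α (range α) ∧ Finset.univ.image α = A →
      ∀ x : ↥(Aᶜ), α x ∈ A := by
    rintro α ⟨-, hA⟩ x
    have := Finset.mem_image_of_mem α (Finset.mem_univ (x : X))
    rwa [hA] at this
  let e : {α : X → X // InjOn α (range α) ∧ Finset.univ.image α = A} ≃
      Equiv.Perm A × (↥(Aᶜ) → ↥A) :=
    { toFun := fun α => (toPerm α, fun x => ⟨α.1 x, hcompl α.1 α.2 x⟩)
      invFun := fun p => ⟨fun x => if h : x ∈ A then (p.1 ⟨x, h⟩ : X)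
          else (p.2 ⟨x, Finset.mem_compl.2 h⟩ : X), by
        have hr : range (fun x => if h : x ∈ A then (p.1 ⟨x, h⟩ : X)
            else (p.2 ⟨x, Finset.mem_compl.2 h⟩ : X)) = (A : Set X) := by
          refine Subset.antisymm ?_ ?_
          · rintro _ ⟨x, rfl⟩
            dsimp only
            split_ifs with h
            · exact (p.1 ⟨x, h⟩).2
            · exact (p.2 _).2
          · intro a ha
            refine ⟨(p.1.symm ⟨a, ha⟩ : X), ?_⟩
            dsimp only
            rw [dif_pos (p.1.symm ⟨a, ha⟩).2]
            simp
        refine ⟨?_, (himage _).2 hr⟩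
        intro a ha a' ha' h
        rw [hr] at ha ha'
        have ha : a ∈ A := ha
        have ha' : a' ∈ A := ha'
        simp only [dif_pos ha, dif_pos ha'] at h
        exact congrArg Subtype.val (p.1.injective (Subtype.ext h))⟩
      left_inv := by
        rintro ⟨α, hα⟩
        apply Subtype.ext
        funext x
        dsimp only
        split_ifs with h
        · rfl
        · rfl
      right_inv := by
        rintro ⟨σ, g⟩
        ext a
        · rw [htoPerm]
          dsimp only
          rw [dif_pos a.2]
        · dsimp only
          rw [dif_neg (Finset.mem_compl.1 a.2)] }
  rw [Nat.card_congr e, Nat.card_eq_fintype_card, Fintype.card_prod, Fintype.card_perm,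
    Fintype.card_fun, Fintype.card_coe, Fintype.card_coe, Finset.card_compl]

/-- **Proposition 5.1.6 (i)**: the full transformation semigroup `𝒯ₙ` (`n ≥ 1`) contains
exactly `∑_{k=1}^{n} (n choose k) k^{n-k} k!` group elements.
[cite: GanyushkinMazorchuk2009, Proposition 5.1.6 (i)] -/
theorem card_groupElements [Fintype X] [DecidableEq X] [Nonempty X] :
    Nat.card {α : X → X // InjOn α (range α)} =
      ∑ k ∈ Finset.Icc 1 (Fintype.card X),
        (Fintype.card X).choose k * k ^ (Fintype.card X - k) * k ! := by
  classical
  -- sort the group elements by their image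
  have h1 : Nat.card {α : X → X // InjOn α (range α)} =
      ∑ A : Finset X, Nat.card {α : X → X // InjOn α (range α) ∧ Finset.univ.image α = A} := by
    rw [Nat.card_eq_fintype_card, Fintype.card_subtype,
      Finset.card_eq_sum_card_fiberwise (f := fun α : X → X => Finset.univ.image α)
        (t := Finset.univ) (fun _ _ => Finset.mem_coe.2 (Finset.mem_univ _))]
    refine Finset.sum_congr rfl fun A _ => ?_
    rw [Nat.card_eq_fintype_card, Fintype.card_subtype, Finset.filter_filter]
  rw [h1]
  simp_rw [card_groupElements_image_eq]
  have h2 : ∑ A : Finset X, (A.card)! * A.card ^ (Fintype.card X - A.card) =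
      ∑ k ∈ Finset.range (Fintype.card X + 1),
        (Fintype.card X).choose k * (k ! * k ^ (Fintype.card X - k)) := by
    have := Finset.sum_powerset_apply_card (fun k => k ! * k ^ (Fintype.card X - k))
      (x := (Finset.univ : Finset X))
    simpa only [Finset.powerset_univ, Finset.card_univ, smul_eq_mul] using this
  rw [h2, Finset.range_eq_Ico, Finset.sum_eq_sum_Ico_succ_bot (Nat.succ_pos _),
    zero_add, Nat.succ_eq_add_one, Finset.Ico_add_one_right_eq_Icc]
  simp only [Nat.choose_zero_right, Nat.factorial_zero, one_mul, Nat.sub_zero,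
    zero_pow Fintype.card_ne_zero, zero_add]
  exact Finset.sum_congr rfl fun k _ => by ring

end Literature.Algebra.Semigroups.FullTransformation
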